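import Summits.CriticalPhenomena.PercolationContinuityZ3.Theorems.Transplant.SkelRootSeedLawF
import Summits.CriticalPhenomena.PercolationContinuityZ3.Theorems.Transplant.SkelPhiWinChainFF2
import HarnessLib

/-!
# N2 (frames-only node `SamePDropOfSkeletonFrm₁`, OPEN), (R) column AFTER J13 ((R-36): the root leg is HOP → BRIDGE → CORRIDOR, as in N1): **THE TWO-WINDOW
# ROOT ASSEMBLY UNDER THE ROOT-SEED LAW OVER (S0) KITS** — `Skel.rootChainF_of_chain₂`, the `KitsAtF`/`RootOblTWF`-shape twin of N1's `Skel.rootOblTWAt_of_chain₂`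

WHY (J13, located by the design owner 2026-08-23T03:48:54Z against the one-corridor instantiation): the first region of ANY schedule reaching back one stride from
its start box (`ScheduleNP.encl`, `La = n`) contains the hop's pinned seed, so `Disjoint (region window) (seed)` — needed for `IsSubbox` under `W0pin` — fails for
a one-segment root leg; N1 ((L-R4)) inserts ONE forced-kit step at the small BRIDGE pair between the hop and the run, whose region clears the seed, and reads the
two segments through two windows.  This file is that assembly with p1's (S0) clause shape (`kitsAt_stepAFF` via `WinChainData.chainF₂`, SkelPhiWinChainFF2) and
the conclusion in the shape of `Skel.RootOblTWF` (SkelRootSeedLawF) with the length exposed; scheme-, window- and frame-generic.  The instantiation (segment 1 =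
N1's `ChainPlanar.bridgeFrame` with `hkits_bridgeFC`, segment 2 = `kgCorrSched` in the landing frame with `hkits_schedFC ∘ hrouteSW_kgCorr`) is the successor file.
builds on p205010 (kernel theorem, internal audit signed; external expert review pending) — nothing in this file uses p205010; nothing here is a claim about
the open node `SamePDropOfSkeletonFrm₁`.
Lane `prim-bschramm`, seat `prim-bschramm-p3` (gen 16; N2 design owner, (R) column owner); helper file (`--supports stmt-CriticalPhenomena-4575 --as helper`).
[cite: KozmaNitzan2024, §4 p. 27 (G₀), p. 28 ((32) at the root), Lemma 11 (pp. 22–23), Lemma 12 (pp. 23–25)] [cite: MartineauTassion2017, §4.3 Lemma 4.2]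
-/

noncomputable section

open MeasureTheory ProbabilityTheory
open scoped ENNReal Classical

namespace Summit.CriticalPhenomena.PercolationContinuityZ3.Theorems

namespace Transplant

namespace Skel

open Literature.Probability.Percolation Literature.Probability.LatticeModels SimpleGraph GadgetSystem ProbeHistory HSiteScheme Contour KNCells
open KNCells.KSchA KNLevels ChainPlanar
open Literature.Barriers.CriticalPhenomena (graphBall mem_graphBall_self)

variable {V : Type} [DecidableEq V] [Countable V] (G : SimpleGraph V) [G.LocallyFinite] {A' : Type*}

/-! ## §1 The root obligation at one direction -/

variable {G}

/-- **THE ROOT LEG OF ONE DIRECTION FROM A TWO-WINDOW CHAIN UNDER THE ROOT-SEED LAW, (S0) KITS, `RootOblTWF` SHAPE** — the `KitsAtF` twin of N1's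
`Skel.rootOblTWAt_of_chain₂` (SkelRootChainW p287070): segment 1 = the BRIDGE frame, segment 2 = the corridor, each read through its own planar window of the
root's ball window graph; pinned seed `A ⊆ Q₀` (internally connected, contains the root); rooms = regions in the cut root world OFF THE SEED, the cross link,
the last core in `M_{a₀}(0+du)`; the hop = ONE link valid for `P_q`; per-segment FORCED-kit clauses (`hkits_bridgeFC` / `hkits_schedFC` shape) at accuracy `δ`;
rim excess `≤ η ≤ δ/2`.  Conclusion: the body of `Skel.RootOblTWF` at `du` with the chain LENGTH `S₁.N + 1 + S₂.N` exposed (J13/(R-36), design owner p3-g16).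
-- non-vacuity: discharged jointly by `SkelFrm1RootHoldsQ` (`NegB.rootLegAt_frmQ3_fst/_snd` at the values of record, through `SkelPhiRootLegBridgeKG`; pending) —
-- the seed-clearance rows `hDA₁/hDA₂` hold there because segment 1 is the bridge frame ((R-F1): `n_L − R′ − pr_b > Rs∥`) and segment 2 starts `Δ₀ ≥ Rs∥ + q + R′ + 1`
-- beyond the hop landing with `q ≤ R′` (J13 analysis 2026-08-23); every other row as in N1's audited `rootOblTWAt_of_chain₂` instantiation (SkelPhiRootChainN).
vertex of it to the root inside `A`; two planar windows `𝒲₁ 𝒲₂` of `winGraph G root Rπ`, two frames `S₁ S₂`, chain data `P₁ P₂` (source the root, support `U'`); the hop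
`1 − δ < P_q(linkIn ↑Qp A T₀)`, `Qp ⊆ U'`, `T₀ ⊆ 𝒲₁.W (S₁.core 0)`; every region inside `U'` and disjoint from `A`; nonempty true targets; the cross link; counts, kits and rim
excesses under `S.W0pin G (edgesIn G A) U'` at accuracy `δ`; the last true target inside `M_{a₀}(0 + du)`.  Then the `RootOblTWF` body at `du`, length `S₁.N + 1 + S₂.N`.
[cite: KozmaNitzan2024, §4 p. 28 ((32) at the root), Lemma 11 (pp. 22–23), Lemma 12 (pp. 23–25)] -/
theorem rootChainF_of_chain₂ {S : KSchA V A'} {du : MDir} {Rπ : ℕ}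
    -- the pinned seed (inside the root cube and the ball, containing the root, internally connected)
    {A : Finset V} (hAQ : A ⊆ S.Γ.Q S.Γ.a₀ 0) (hAπ : ∀ a ∈ A, a ∈ graphBall G S.Γ.root Rπ) (htA : S.Γ.root ∈ A)
    (hAconn : ∀ a ∈ A, PathIn G (↑A : Set V) S.Γ.root a)
    -- two windows of the root's ball window graph, two frames, chain data
    (𝒲₁ 𝒲₂ : Skelφ.PlanarWindow (winGraph G S.Γ.root Rπ)) (S₁ S₂ : SchedFrame) (P₁ P₂ : Skelφ.WinChainData V)
    (hPo₁ : P₁.o = S.Γ.root) (hPo₂ : P₂.o = S.Γ.root)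
    (hPS₁ : P₁.Sfin = (S.U0root du).filter fun y => y ∈ graphBall G S.Γ.root Rπ)
    (hPS₂ : P₂.Sfin = (S.U0root du).filter fun y => y ∈ graphBall G S.Γ.root Rπ)
    (hRim₁ : ∀ k, P₁.Rim k ⊆ 𝒲₁.stepDF S₁ k) (hRim₂ : ∀ k, P₂.Rim k ⊆ 𝒲₂.stepDF S₂ k)
    (hRl₁ : P₁.Rlev + 1 ≤ S₁.R') (hRl₂ : P₂.Rlev + 1 ≤ S₂.R') (hj₁ : P₁.j₁ ≤ P₁.Rlev) (hj₂ : P₂.j₁ ≤ P₂.Rlev)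
    (hTne₁ : ∀ k ≤ S₁.N, (𝒲₁.coreTF S₁ k).Nonempty) (hTne₂ : ∀ k ≤ S₂.N, (𝒲₂.coreTF S₂ k).Nonempty)
    -- the rooms: regions inside the cut root world, off the pinned seed; the cross link; the last core inside `M_{a₀}(0+du)`
    (hDU₁ : ∀ k ≤ S₁.N, 𝒲₁.stepDF S₁ k ⊆ (S.U0root du).filter fun y => y ∈ graphBall G S.Γ.root Rπ)
    (hDU₂ : ∀ k ≤ S₂.N, 𝒲₂.stepDF S₂ k ⊆ (S.U0root du).filter fun y => y ∈ graphBall G S.Γ.root Rπ)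
    (hDA₁ : ∀ k ≤ S₁.N, Disjoint (𝒲₁.stepDF S₁ k) A) (hDA₂ : ∀ k ≤ S₂.N, Disjoint (𝒲₂.stepDF S₂ k) A)
    (hx : 𝒲₁.coreTF S₁ S₁.N ⊆ 𝒲₂.W (S₂.core 0))
    (hlast : 𝒲₂.coreTF S₂ S₂.N ⊆ S.Γ.M S.Γ.a₀ ((0 : Site 2) + stepVec du))
    -- the hop: ONE link input valid for `P_q`, prism inside the world, target inside the first level
    {Δ' : ℕ} {δ : ℝ} {η : ℝ} {Qp T₀ : Finset V}
    (hlink : 1 - δ < (bondPercolation G S.p).real (linkIn (↑Qp : Set V) A T₀))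
    (hQU : Qp ⊆ (S.U0root du).filter fun y => y ∈ graphBall G S.Γ.root Rπ) (hT₀ : T₀ ⊆ 𝒲₁.W (S₁.core 0))
    -- analytic inputs under the root-seed law, accuracy `δ` (forced-kit clause shape)
    (hcount₁ : 1 / (1 - (S.p : ℝ)) ^ (Δ' * P₁.N) ≤ δ * ((Finset.Icc P₁.j₀ P₁.j₁).card : ℝ))
    (hcount₂ : 1 / (1 - (S.p : ℝ)) ^ (Δ' * P₂.N) ≤ δ * ((Finset.Icc P₂.j₀ P₂.j₁).card : ℝ))
    (hkits₁ : ∀ k ≤ S₁.N, ∀ j ∈ Finset.Icc P₁.j₀ P₁.j₁, ∃ (σ : SData V) (Sz : Finset V),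
      SHyp (P₁.stepLF 𝒲₁ S₁ k) j σ ∧ σ.N ≤ P₁.N ∧ (1 - (S.p : ℝ) ^ σ.sB) ^ σ.k ≤ δ ∧ Sz ⊆ 𝒲₁.stepDF S₁ k ∧ (∀ x ∈ σ.K, σ.face x ⊆ Sz) ∧
      RelayClause (P₁.stepLF 𝒲₁ S₁ k) (S.W0pin G (edgesIn G A) ((S.U0root du).filter fun y => y ∈ graphBall G S.Γ.root Rπ)) j σ Sz
        (P₁.coreEF 𝒲₁ S₁ k) (𝒲₁.stepDF S₁ k) δ)
    (hkits₂ : ∀ k ≤ S₂.N, ∀ j ∈ Finset.Icc P₂.j₀ P₂.j₁, ∃ (σ : SData V) (Sz : Finset V),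
      SHyp (P₂.stepLF 𝒲₂ S₂ k) j σ ∧ σ.N ≤ P₂.N ∧ (1 - (S.p : ℝ) ^ σ.sB) ^ σ.k ≤ δ ∧ Sz ⊆ 𝒲₂.stepDF S₂ k ∧ (∀ x ∈ σ.K, σ.face x ⊆ Sz) ∧
      RelayClause (P₂.stepLF 𝒲₂ S₂ k) (S.W0pin G (edgesIn G A) ((S.U0root du).filter fun y => y ∈ graphBall G S.Γ.root Rπ)) j σ Sz
        (P₂.coreEF 𝒲₂ S₂ k) (𝒲₂.stepDF S₂ k) δ)
    (hη : η ≤ δ / 2)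
    (hexc₁ : ∀ k ≤ S₁.N, (prodBernoulli (S.W0pin G (edgesIn G A) ((S.U0root du).filter fun y => y ∈ graphBall G S.Γ.root Rπ))).real
      (⋃ t' ∈ P₁.Rim k, openConn S.Γ.root t') ≤ η)
    (hexc₂ : ∀ k ≤ S₂.N, (prodBernoulli (S.W0pin G (edgesIn G A) ((S.U0root du).filter fun y => y ∈ graphBall G S.Γ.root Rπ))).real
      (⋃ t' ∈ P₂.Rim k, openConn S.Γ.root t') ≤ η) :
    ∃ (c : V) (R₀ : ℕ) (W : Sym2 V → unitInterval) (s : Fin (S₁.N + 1 + S₂.N + 1) → KNLevels.TStep (winGraph G c R₀))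
      (T' : Fin (S₁.N + 1 + S₂.N + 1) → Finset V) (η' : ℝ),
      (∀ T : Finset V, (prodBernoulli W).real (⋃ t ∈ T, openConn S.Γ.root t) ≤
        (prodBernoulli (pinW (KNLevels.lattW G S.p) ↑(S.U₀ G) ↑(S.U₀ G))).real
          (⋃ t ∈ (↑T : Set V), openConnIn (↑(S.Γ.Q S.Γ.a₀ 0 ∪ S.Γ.Ewv S.Γ.a₀ 0 du) : Set V) S.Γ.root t)) ∧
      (∀ i : Fin (S₁.N + 1 + S₂.N + 1), (s i).L.o = S.Γ.root) ∧
      (∀ i : Fin (S₁.N + 1 + S₂.N), T' (Fin.castSucc i) ⊆ (s i.succ).L.X 0) ∧ (∀ i : Fin (S₁.N + 1 + S₂.N + 1), T' i ⊆ (s i).T) ∧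
      (∀ i : Fin (S₁.N + 1 + S₂.N + 1), (s i).KitsAtF W S.p Δ' δ) ∧ η' ≤ δ / 2 ∧
      (∀ i : Fin (S₁.N + 1 + S₂.N + 1), (prodBernoulli W).real (⋃ t ∈ (s i).T \ T' i, openConn S.Γ.root t) ≤ η') ∧
      1 - δ < (prodBernoulli W).real (s 0).L.reachB ∧
      T' (Fin.last (S₁.N + 1 + S₂.N)) ⊆ S.Γ.M S.Γ.a₀ ((0 : Site 2) + stepVec du) := by
  set U' : Finset V := (S.U0root du).filter fun y => y ∈ graphBall G S.Γ.root Rπ with hU'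
  set F : Finset (Sym2 V) := edgesIn G A with hF
  set W : Sym2 V → unitInterval := S.W0pin G F U' with hW
  set n : ℕ := S₁.N + 1 + S₂.N with hn
  -- the seed: its pairs are cube edges, its vertices lie in the cut world
  have hFA : ∀ e ∈ F, ∀ w ∈ e, w ∈ A := fun e he w hw => ((mem_edgesIn_iff).1 he).2 w hw
  have hFU₀ : F ⊆ S.U₀ G := by
    intro e he
    rw [KSchA.U₀, mem_edgesIn_iff]
    obtain ⟨heG, heA⟩ := (mem_edgesIn_iff).1 he
    exact ⟨heG, fun x hx => hAQ (heA x hx)⟩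
  have hAU : A ⊆ U' := fun a ha => Finset.mem_filter.2 ⟨Finset.mem_union_left _ (hAQ ha), hAπ a ha⟩
  have hrootU : S.Γ.root ∈ U' := hAU htA
  have hU'sub : U' ⊆ S.U0root du := Finset.filter_subset _ _
  -- subbox regions (off the seed), the source off the regions
  have hfresh : ∀ {Dd : Finset V}, Disjoint Dd A → ∀ u ∈ Dd, ∀ z, s(u, z) ∉ F := fun hdis => KSchA.fresh_of_disjoint hFA hdis
  have hsub₁ : ∀ k ≤ S₁.N, IsSubbox (winGraph G S.Γ.root Rπ) W S.p (𝒲₁.stepDF S₁ k) :=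
    fun k hk => isSubbox_W0pin_win (S := S) S.Γ.root Rπ (U := S.U0root du) (hDU₁ k hk) (hfresh (hDA₁ k hk))
  have hsub₂ : ∀ k ≤ S₂.N, IsSubbox (winGraph G S.Γ.root Rπ) W S.p (𝒲₂.stepDF S₂ k) :=
    fun k hk => isSubbox_W0pin_win (S := S) S.Γ.root Rπ (U := S.U0root du) (hDU₂ k hk) (hfresh (hDA₂ k hk))
  have ho₁ : ∀ k ≤ S₁.N, P₁.o ∉ 𝒲₁.stepDF S₁ k := fun k hk h' => by
    rw [hPo₁] at h'; exact Finset.disjoint_left.1 (hDA₁ k hk) h' htA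
  have ho₂ : ∀ k ≤ S₂.N, P₂.o ∉ 𝒲₂.stepDF S₂ k := fun k hk h' => by
    rw [hPo₂] at h'; exact Finset.disjoint_left.1 (hDA₂ k hk) h' htA
  -- the two-window chain
  have hC := Skelφ.WinChainData.chainF₂ P₁ P₂ 𝒲₁ 𝒲₂ S₁ S₂ (hPo₂.trans hPo₁.symm) hRl₁ hRim₁ hTne₁ hRl₂ hRim₂ hTne₂ hx
    (p := S.p) (W' := W) (Δ' := Δ') (δ := δ) (η := η)
    hsub₁ (by rw [hPS₁]; exact KSchA.finSupp_W0pin) (fun k hk => by rw [hPS₁]; exact hDU₁ k hk) ho₁ (by rw [hPo₁, hPS₁]; exact hrootU) hj₁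
    hcount₁ hkits₁ (fun k hk => by rw [hPo₁]; exact hexc₁ k hk)
    hsub₂ (by rw [hPS₂]; exact KSchA.finSupp_W0pin) (fun k hk => by rw [hPS₂]; exact hDU₂ k hk) ho₂ (by rw [hPo₂, hPS₂]; exact hrootU) hj₂
    hcount₂ hkits₂ (fun k hk => by rw [hPo₁]; exact hexc₂ k hk)
  obtain ⟨ho, hlinkC, hsubC, hkitsC, hexcC, h0, hlastC⟩ := hC
  -- the hop under the root-seed law
  have hwired : ∀ u ∈ A, ∀ u' ∈ A, G.Adj u u' → s(u, u') ∈ F := fun u hu u' hu' hadj =>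
    (mem_edgesIn_iff).2 ⟨(SimpleGraph.mem_edgeSet G).2 hadj, fun x hx => by
      rcases Sym2.mem_iff.1 hx with rfl | rfl
      · exact hu
      · exact hu'⟩
  have hsrc : 1 - δ < (prodBernoulli W).real (⋃ t' ∈ T₀, openConn S.Γ.root t') :=
    root_hsrc_of_pinned (S := S) hlink hQU hAU subset_rfl hAconn hwired
  refine ⟨S.Γ.root, Rπ, W, fun i => Skelφ.WinChainData.stepAF₂ P₁ P₂ 𝒲₁ 𝒲₂ S₁ S₂ i, fun i => Skelφ.WinChainData.coreTF₂ 𝒲₁ 𝒲₂ S₁ S₂ i, η,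
    fun T => KSchA.real_W0pin_le_rootLaw hFU₀ hU'sub hrootU T, fun i => (ho i).trans hPo₁, hlinkC, hsubC, hkitsC, hη,
    fun i => by have h := hexcC i; rw [hPo₁] at h; exact h, ?_, ?_⟩
  · -- the source bound: `T₀ ⊆ X^{(0)}_0 = 𝒲₁.W (S₁.core 0)`
    refine hsrc.trans_le (measureReal_mono ?_ (measure_ne_top _ _))
    intro ω hω
    simp only [Set.mem_iUnion, exists_prop] at hω
    obtain ⟨t', ht', hωt⟩ := hω
    have ht'' : t' ∈ (Skelφ.WinChainData.stepAF₂ P₁ P₂ 𝒲₁ 𝒲₂ S₁ S₂ ((0 : Fin (n + 1)) : ℕ)).L.X 0 := by rw [h0]; exact hT₀ ht'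
    have hoo : (Skelφ.WinChainData.stepAF₂ P₁ P₂ 𝒲₁ 𝒲₂ S₁ S₂ ((0 : Fin (n + 1)) : ℕ)).L.o = S.Γ.root := (ho 0).trans hPo₁
    show ω ∈ (Skelφ.WinChainData.stepAF₂ P₁ P₂ 𝒲₁ 𝒲₂ S₁ S₂ ((0 : Fin (n + 1)) : ℕ)).L.reachB
    rw [LData.reachB, hoo]
    exact Set.mem_biUnion (Finset.mem_coe.2 ht'') hωt
  · -- the last true target enters `M_{a₀}(0 + du)`
    rw [hlastC]; exact hlast

end Skel

end Transplant

end Summit.CriticalPhenomena.PercolationContinuityZ3.Theorems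

end
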